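import Summits.AnomalousDissipation.AnomalousDissipation.Theorems.SolenoidalFractalHomogenisationRealisedQuasiStaticCellLawWeakFarSlotAlgebra
import Summits.AnomalousDissipation.AnomalousDissipation.Theorems.SolenoidalFractalHomogenisationRealisedQuasiStaticCellLawSlotGainFrame
import Summits.AnomalousDissipation.AnomalousDissipation.Theorems.SolenoidalFractalHomogenisationRealisedQuasiStaticCellLawComovingFrameBridge
import Summits.AnomalousDissipation.AnomalousDissipation.Theorems.SolenoidalFractalHomogenisationRealisedQuasiStaticCellLawIsotropicGainScale
import HarnessLib

/-!
# K2R `RealisedQuasiStaticCellLaw`, line `floquet-bloch`, stub `stub_lowSectorWeakNear`: the isotropy identity of the cubature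
# word in co-moving frame coordinates (helper; `--supports stmt-AnomalousDissipation-20446`)

Summits-side helper file (everything proved; no definitions, no named facts). The hypothesis `hG` of `iso_mu_lower` for the
cubature word: with the sector direction `k̂ = ℓ/‖ℓ‖`, a reference normal `ζ₀ = ζ_{j₀}` (`ζ_j ⊥ ℓ, m_j`, unit), the rotations
`rc_j = ζ₀·ζ_j`, `rs_j = (k̂ × ζ₀)·ζ_j` and the polarisation cosines `ĉ_j = (m_j·ℓ)/(‖m_j‖‖ℓ‖)`,
`Σ_j slotTerm_j(ℓ,0)·((rc_j z₁ + rs_j z₂)² + ĉ_j²(−rs_j z₁ + rc_j z₂)²) = c0·3720·‖ℓ‖²·(z₁² + z₂²)`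
(`isotropicWordGain_cubatureWord` through `slotGain_frame`, `frame_bridge_unit` and `cubature_coupling_sq`): `iso_isotropy_sum`.
-/

set_option linter.dupNamespace false

noncomputable section

namespace Summit.AnomalousDissipation.AnomalousDissipation.Theorems.SolenoidalFractalHomogenisation.RealisedQuasiStaticCellLaw

open Matrix
open scoped InnerProductSpace Matrix
open Literature.Analysis Literature.Analysis.FunctionSpaces Literature.Analysis.FunctionSpaces.Torus
open Literature.Analysis.FluidPDE Literature.Analysis.FluidPDE.LatticeShear

/-- **Isotropy of the cubature word in co-moving frame coordinates.** -/
theorem iso_isotropy_sum (ℓ : Fin 3 → ℤ) (hℓ : ℓ ≠ 0) (ζr : Fin 26 → Fin 3 → ℝ)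
    (hζ1 : ∀ j, ζr j ⬝ᵥ ζr j = 1) (hζ0 : ∀ j, ζr j ⬝ᵥ (fun i => ((ℓ i : ℤ) : ℝ)) = 0)
    (hζm : ∀ j, ζr j ⬝ᵥ (fun i => (((cubatureWord.phase j).m i : ℤ) : ℝ)) = 0) (j₀ : Fin 26) (z₁ z₂ : ℝ) :
    ∑ j, slotTerm (slots j) (latticeVec ℓ) 0 *
        ((ζr j₀ ⬝ᵥ ζr j * z₁ +
            (((Real.sqrt ((fun i => ((ℓ i : ℤ) : ℝ)) ⬝ᵥ (fun i => ((ℓ i : ℤ) : ℝ))))⁻¹ • (fun i => ((ℓ i : ℤ) : ℝ))) ⨯₃ ζr j₀)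
              ⬝ᵥ ζr j * z₂) ^ 2 +
          (⟪latticeVec (cubatureWord.phase j).m, latticeVec ℓ⟫_ℝ / (‖latticeVec (cubatureWord.phase j).m‖ * ‖latticeVec ℓ‖)) ^ 2 *
            (-((((Real.sqrt ((fun i => ((ℓ i : ℤ) : ℝ)) ⬝ᵥ (fun i => ((ℓ i : ℤ) : ℝ))))⁻¹ • (fun i => ((ℓ i : ℤ) : ℝ))) ⨯₃ ζr j₀)
              ⬝ᵥ ζr j) * z₁ + ζr j₀ ⬝ᵥ ζr j * z₂) ^ 2) =
      c0 * 3720 * ‖latticeVec ℓ‖ ^ 2 * (z₁ ^ 2 + z₂ ^ 2) := by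
  classical
  have hinner : ∀ a b : EuclideanSpace ℝ (Fin 3), ⟪a, b⟫_ℝ = WithLp.ofLp a ⬝ᵥ WithLp.ofLp b := by
    intro a b
    rw [EuclideanSpace.inner_eq_star_dotProduct, star_trivial, dotProduct_comm]
  have hℓr : ∀ k : Fin 3 → ℤ, WithLp.ofLp (latticeVec k) = (fun i => ((k i : ℤ) : ℝ)) := by
    intro k; funext i; simp [latticeVec_apply]
  obtain ⟨hxx, hsq, -⟩ := dot_cast_facts ℓ ℓ
  have ha0 : 0 < ‖latticeVec ℓ‖ := lt_of_lt_of_le one_pos (one_le_norm_latticeVec hℓ)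
  rw [hsq]
  obtain ⟨kh, hkh⟩ : ∃ kh : Fin 3 → ℝ, kh = (‖latticeVec ℓ‖)⁻¹ • (fun i => ((ℓ i : ℤ) : ℝ)) := ⟨_, rfl⟩
  rw [← hkh]
  -- the reference frame
  have hkk : kh ⬝ᵥ kh = 1 := by
    rw [hkh, smul_dotProduct, dotProduct_smul, hxx, smul_eq_mul, smul_eq_mul]
    field_simp
  have hk0 : kh ⬝ᵥ ζr j₀ = 0 := by rw [hkh, smul_dotProduct, dotProduct_comm, hζ0 j₀, smul_zero]
  have h00 : ζr j₀ ⬝ᵥ ζr j₀ = 1 := hζ1 j₀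
  have hww : (kh ⨯₃ ζr j₀) ⬝ᵥ (kh ⨯₃ ζr j₀) = 1 := frame_e2_dot_e2 (ζr j₀) kh h00 hkk hk0
  have hw0 : (kh ⨯₃ ζr j₀) ⬝ᵥ ζr j₀ = 0 := frame_e2_dot_e1 (ζr j₀) kh
  have hwk : (kh ⨯₃ ζr j₀) ⬝ᵥ kh = 0 := frame_e2_dot_e3 (ζr j₀) kh
  -- the unit sector direction `q` and the transverse vector `p`
  obtain ⟨q, hq⟩ : ∃ q : EuclideanSpace ℝ (Fin 3), q = (‖latticeVec ℓ‖)⁻¹ • latticeVec ℓ := ⟨_, rfl⟩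
  have hq' : WithLp.ofLp q = kh := by rw [hq, WithLp.ofLp_smul, hℓr, hkh]
  have hqn : ‖q‖ = 1 := by
    rw [hq, norm_smul, Real.norm_eq_abs, abs_inv, abs_of_pos ha0, inv_mul_cancel₀ ha0.ne']
  obtain ⟨p, hp⟩ : ∃ p : EuclideanSpace ℝ (Fin 3), p = WithLp.toLp 2 (z₁ • ζr j₀ + z₂ • (kh ⨯₃ ζr j₀)) := ⟨_, rfl⟩
  have hp' : WithLp.ofLp p = z₁ • ζr j₀ + z₂ • (kh ⨯₃ ζr j₀) := by rw [hp]
  have hpq : ⟪p, q⟫_ℝ = 0 := by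
    rw [hinner, hp', hq', add_dotProduct, smul_dotProduct, smul_dotProduct, dotProduct_comm (ζr j₀) kh, hk0, hwk,
      smul_zero, smul_zero, add_zero]
  have hpn : ‖p‖ ^ 2 = z₁ ^ 2 + z₂ ^ 2 := by
    rw [← real_inner_self_eq_norm_sq, hinner, hp', add_dotProduct, dotProduct_add, dotProduct_add, smul_dotProduct,
      smul_dotProduct, smul_dotProduct, smul_dotProduct, dotProduct_smul, dotProduct_smul, dotProduct_smul,
      dotProduct_smul, h00, hww, hw0, dotProduct_comm (ζr j₀) (kh ⨯₃ ζr j₀), hw0]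
    simp only [smul_eq_mul, mul_zero, mul_one, add_zero, zero_add]
    ring
  -- the total gain
  have htot := isotropicWordGain_norm_sq isotropicWordGain_cubatureWord q p hqn hpq
  rw [period_cubatureWord, hpn] at htot
  -- per slot
  have hslot : ∀ j, slotGain (cubatureWord.phase j) q p =
      (‖latticeVec ℓ‖)⁻¹ ^ 2 * (slotTerm (slots j) (latticeVec ℓ) 0 *
        ((ζr j₀ ⬝ᵥ ζr j * z₁ + (kh ⨯₃ ζr j₀) ⬝ᵥ ζr j * z₂) ^ 2 +
          (⟪latticeVec (cubatureWord.phase j).m, latticeVec ℓ⟫_ℝ /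
              (‖latticeVec (cubatureWord.phase j).m‖ * ‖latticeVec ℓ‖)) ^ 2 *
            (-((kh ⨯₃ ζr j₀) ⬝ᵥ ζr j) * z₁ + ζr j₀ ⬝ᵥ ζr j * z₂) ^ 2)) := by
    intro j
    have hbm : 0 < ‖latticeVec (cubatureWord.phase j).m‖ :=
      lt_of_lt_of_le one_pos (one_le_norm_latticeVec (cubatureWord.phase j).m_ne)
    have hζq : ζr j ⬝ᵥ WithLp.ofLp q = 0 := by rw [hq', hkh, dotProduct_smul, hζ0 j, smul_zero]
    have hζk : ζr j ⬝ᵥ kh = 0 := by rw [← hq']; exact hζq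
    have hζmj : ζr j ⬝ᵥ WithLp.ofLp (latticeVec (cubatureWord.phase j).m) = 0 := by rw [hℓr]; exact hζm j
    rw [slotGain_frame (cubatureWord.phase j) q p hqn hpq (hζ1 j) hζq hζmj]
    have he : ⟪(cubatureWord.phase j).e, q⟫_ℝ = (‖latticeVec ℓ‖)⁻¹ * ∑ i, (cubatureWord.phase j).e i * (ℓ i : ℝ) := by
      rw [hq, real_inner_smul_right, sum_mul_intCast_eq_inner]
    have hm : ⟪(1 / ‖latticeVec (cubatureWord.phase j).m‖) • latticeVec (cubatureWord.phase j).m, q⟫_ℝ =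
        (1 / ‖latticeVec (cubatureWord.phase j).m‖) * ((‖latticeVec ℓ‖)⁻¹ *
          ⟪latticeVec (cubatureWord.phase j).m, latticeVec ℓ⟫_ℝ) := by
      rw [hq, real_inner_smul_left, real_inner_smul_right]
    obtain ⟨hexp, hcr, -⟩ := frame_bridge_unit (ζr j₀) kh (ζr j) h00 hkk hk0 (hζ1 j) hζk
    have hζp : ζr j ⬝ᵥ WithLp.ofLp p = ζr j₀ ⬝ᵥ ζr j * z₁ + (kh ⨯₃ ζr j₀) ⬝ᵥ ζr j * z₂ := by
      rw [hp']
      conv_lhs => rw [hexp]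
      rw [add_dotProduct, smul_dotProduct, smul_dotProduct, dotProduct_add, dotProduct_add, dotProduct_smul,
        dotProduct_smul, dotProduct_smul, dotProduct_smul, h00, hww, hw0, dotProduct_comm (ζr j₀) (kh ⨯₃ ζr j₀), hw0]
      simp only [smul_eq_mul, mul_zero, mul_one, add_zero, zero_add]
    have hkζp : (WithLp.ofLp q ⨯₃ ζr j) ⬝ᵥ WithLp.ofLp p = -((kh ⨯₃ ζr j₀) ⬝ᵥ ζr j) * z₁ + ζr j₀ ⬝ᵥ ζr j * z₂ := by
      rw [hq', hp', hcr, add_dotProduct, neg_dotProduct, smul_dotProduct, smul_dotProduct, dotProduct_add,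
        dotProduct_add, dotProduct_smul, dotProduct_smul, dotProduct_smul, dotProduct_smul, h00, hww, hw0,
        dotProduct_comm (ζr j₀) (kh ⨯₃ ζr j₀), hw0]
      simp only [smul_eq_mul, mul_zero, mul_one, add_zero, zero_add]
      ring
    rw [he, hm, hζp, hkζp, ← cubature_coupling_sq j ℓ]
    field_simp
  have hsum : ∑ j, slotGain (cubatureWord.phase j) q p = (‖latticeVec ℓ‖)⁻¹ ^ 2 *
      ∑ j, slotTerm (slots j) (latticeVec ℓ) 0 *
        ((ζr j₀ ⬝ᵥ ζr j * z₁ + (kh ⨯₃ ζr j₀) ⬝ᵥ ζr j * z₂) ^ 2 +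
          (⟪latticeVec (cubatureWord.phase j).m, latticeVec ℓ⟫_ℝ /
              (‖latticeVec (cubatureWord.phase j).m‖ * ‖latticeVec ℓ‖)) ^ 2 *
            (-((kh ⨯₃ ζr j₀) ⬝ᵥ ζr j) * z₁ + ζr j₀ ⬝ᵥ ζr j * z₂) ^ 2) := by
    rw [Finset.mul_sum]
    exact Finset.sum_congr rfl fun j _ => hslot j
  rw [hsum, inv_pow, inv_mul_eq_iff_eq_mul₀ (pow_ne_zero 2 ha0.ne')] at htot
  rw [htot]
  ring_nf

end Summit.AnomalousDissipation.AnomalousDissipation.Theorems.SolenoidalFractalHomogenisation.RealisedQuasiStaticCellLaw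

end
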